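import Summits.QuantumFields.YangMills.Theorems.BalabanUVNodesN08HaarCompatibilityGuardTransport

/-!
# BalabanUVNodes ∕ N08 — THE HYBRID AVERAGING `Ū^S` (print's typed (0.4) averaging on a set `S` of coarse bonds, the AXIAL averaging off `S`) AND THE
# POSITIVE POLYMER PARTITION OF THE ONE-STEP TRANSPORT: `μ∘Ū⁻¹ = Σ_S (μ↾{guard set = S})∘(Ū^S)⁻¹ ≤ Σ_S (μ↾G_S)∘(Ū^S)⁻¹` for EVERY input measure `μ`

WIDTH SEAT `pub-ymgap-dag-n08-w3` g7, item-3 lineage PART 34 (successor of part 15 p609378 `…GuardTransport`, whose two-term split `Ū = axial` off the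
GLOBAL guard `{∃ c, Small}` this file refines bond by bond), 2026-08-28.  Track A, DAG node N08 = [Balaban1985UV3] Thm 1 p. 257 (compact) + Thm 2 p. 272;
key item K1⁷ `StabilityBAtRecordR13SepCoPH` (stmt-QuantumFields-20542), `--supports … --as helper`.  COUNT-NEUTRAL.

THE POINT (located; n08-w1 g6's design note `N08-NO-STACKING-MECHANISM.md` §3 (G1), count-neutral).  Road (ii) for the floored Haar iterate needs the
transported GUARDED part of a density to be (G1) LOCAL near the guarded bonds, with small mass and bounded sup.  Print's own averaging `Ū = avgFun ℰ`
restricted to «no guard outside `S`» is NOT the right carrier of locality: the event `¬Small U c′` of a far bond `c′` reads the central line of `c′` itself, so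
conditioning on it biases the far coarse variables.  The carrier is the HYBRID map
  `Ū^S U c := if c ∈ S then Ū U c else axial U c`   (written inline throughout — no definition is introduced),
which agrees with `Ū` on `{U | ∀ c ∉ S, ¬Small U c}` (per bond, `BlockAveragingHaarAC.avgFun_of_not_small`) and whose far coordinates are plain line
products — fresh Haar variables (part 35 `…GuardHybridFresh`) — while its guarded coordinates carry the lineage's fibre-law bounds with exponent `|S|` instead of
`#PBond(j+1)` (part 36 `…GuardHybridDensity`).  This file is the bookkeeping base:

* §1 `avgFun_eq_hybrid_of_forall_not_small` (agreement), `measurable_hybrid`, ★ `hybrid_apply_eq_of_mem` ∕ `hybrid_apply_eq_of_not_mem` (LOCALITY LETTERS: the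
  `S`-coordinates read only the end blocks of `S`, the other coordinates only their own line).
* §2 `measurableSet_guardEq`, `eq_sum_restrict_guardEq` (the events `{U | {c | Small U c} = S}`, `S ⊆ PBond(j+1)`, partition the fine fields), ★★
  `map_avgFun_eq_sum_map_hybrid` — **`μ∘Ū⁻¹ = Σ_S (μ↾{guard set = S})∘(Ū^S)⁻¹`** (exact, every measure `μ`), ★★ `map_avgFun_le_sum_map_hybrid` —
  **`μ∘Ū⁻¹ ≤ Σ_S (μ↾G_S)∘(Ū^S)⁻¹`**, `G_S = {∀ c ∈ S, Small U c}` (the POSITIVE polymer partition: an upper bound with no signs, the shape road (ii) sums),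
  `map_restrict_noGuardOff_eq_map_hybrid` (one `S`: on «no guard outside `S`» print's transport IS the hybrid one), `sum_measure_guardEq_eq` (the exact partition
  has total mass `μ(univ)`).
* §3 the same at the [B10] slot's averaging `avOfPrint N S₀ j` on `SU(N)`, every `N`, standing range.

HONEST FRAMING.  [folklore] measure theory ∕ lattice bookkeeping over pub-balaban's `BlockAveraging` ∕ `AveragingRT` and part 15 BY IMPORT; nothing of Bałaban's
asserted; no density bound, no cluster expansion, no k-uniform `hmass`; E6′ NOT decided; N08 NOT discharged; counts unmoved (typed 28∕28 · discharged 5∕27); one finite 𝕋⁴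
programme at fixed ε — R4 closes the CONDITIONAL rung `BalabanLadder.UV` only; the Yang–Mills mass gap (Clay) is NOT proved by any of this; nothing continuum ∕ ℝ⁴ ∕ OS.
0 `sorry`, 0 `def`, 0 `instance`, standard axioms.
-/

noncomputable section

open MeasureTheory
open scoped ENNReal

namespace Summit.QuantumFields.YangMills.BalabanUVNodes.N08HaarCompatibilityGuardHybridPartition

open Literature.MathematicalPhysics.QuantumFieldTheory.Balaban1983to89
open Literature.MathematicalPhysics.QuantumFieldTheory.Balaban1983to89.AveragingRT
  (axialAvg measurable_axialAvg axialAvg_local pathProd line lineSite blockOf_lineSite)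
open Literature.MathematicalPhysics.QuantumFieldTheory.Balaban1983to89.BlockAveraging
  (Small avgFun measurable_avgFun avgFun_local loopHol_local measurableSet_small)
open Literature.MathematicalPhysics.QuantumFieldTheory.Balaban1983to89.BlockAveragingHaarAC (avgFun_of_not_small)

/-! ## §1 The hybrid averaging: agreement with print's averaging, measurability, locality letters -/

section Hybrid

variable {P : Params} {j : ℕ} {G : Type*} [GaugeGroup G] (ℰ : LoopAverage G) [DecidableEq (PBond P (j + 1))]

/-- **AGREEMENT**: if no bond outside `S` is guarded at `U`, print's typed averaging IS the hybrid averaging at `U` (per bond: off the small-field domain the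
correction factor is `1`, `avgFun_of_not_small`). [cite: Balaban1987RG1, (0.4) p.253 (bookkeeping)] -/
theorem avgFun_eq_hybrid_of_forall_not_small (S : Finset (PBond P (j + 1))) {U : GaugeField P j G} (hU : ∀ c, c ∉ S → ¬ Small ℰ U c) :
    avgFun ℰ U = fun c => if c ∈ S then avgFun ℰ U c else axialAvg U c := by
  funext c
  by_cases hc : c ∈ S
  · rw [if_pos hc]
  · rw [if_neg hc, avgFun_of_not_small ℰ U c (hU c hc)]

/-- ★ **LOCALITY LETTER, GUARDED COORDINATES**: for `c ∈ S` the hybrid coordinate `Ū^S(c) = Ū(c)` reads only the bonds issuing from the end blocks `B(c₋) ∪ B(c₊)`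
(pub-balaban's `avgFun_local`, standing range). [cite: Balaban1985Averaging, p.19 (locality; bookkeeping)] -/
theorem hybrid_apply_eq_of_mem (hj : j + 1 ≤ P.m + P.K) (S : Finset (PBond P (j + 1))) {c : PBond P (j + 1)} (hc : c ∈ S)
    {U U' : GaugeField P j G} (hUU' : ∀ b : PBond P j, (blockOf b.src = c.src ∨ blockOf b.src = c.tgt) → U b = U' b) :
    (if c ∈ S then avgFun ℰ U c else axialAvg U c) = (if c ∈ S then avgFun ℰ U' c else axialAvg U' c) := by
  rw [if_pos hc, if_pos hc, avgFun_local ℰ hj U U' c hUU']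

/-- ★ **LOCALITY LETTER, UNGUARDED COORDINATES**: for `c ∉ S` the hybrid coordinate `Ū^S(c) = axial(c)` reads only the bonds `line c s`, `s < L`, of its own
central line (the line product is an ordered product of exactly these bond variables; cf. n08-w1's `…AxialDecimationFarFresh.axialAvg_congr_line`, not imported here to
keep this base module light). [cite: Balaban1984PropagatorsI, (1.7) p.18 (the straight contour; bookkeeping)] -/
theorem hybrid_apply_eq_of_not_mem (S : Finset (PBond P (j + 1))) {c : PBond P (j + 1)} (hc : c ∉ S)
    {U U' : GaugeField P j G} (hUU' : ∀ s, s < P.L → U (line c s) = U' (line c s)) :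
    (if c ∈ S then avgFun ℰ U c else axialAvg U c) = (if c ∈ S then avgFun ℰ U' c else axialAvg U' c) := by
  rw [if_neg hc, if_neg hc]
  have key : ∀ n, n ≤ P.L → pathProd U c n = pathProd U' c n := by
    intro n hn
    induction n with
    | zero => rfl
    | succ n ih => simp only [pathProd, ih (by omega), hUU' n (by omega)]
  exact key _ le_rfl

/-- The unguarded coordinates also read only the end blocks (coarser letter, standing range). [cite: Balaban1985Averaging, p.19 (locality; bookkeeping)] -/
theorem hybrid_apply_local (hj : j + 1 ≤ P.m + P.K) (S : Finset (PBond P (j + 1))) (c : PBond P (j + 1))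
    {U U' : GaugeField P j G} (hUU' : ∀ b : PBond P j, (blockOf b.src = c.src ∨ blockOf b.src = c.tgt) → U b = U' b) :
    (if c ∈ S then avgFun ℰ U c else axialAvg U c) = (if c ∈ S then avgFun ℰ U' c else axialAvg U' c) := by
  by_cases hc : c ∈ S
  · exact hybrid_apply_eq_of_mem ℰ hj S hc hUU'
  · rw [if_neg hc, if_neg hc, axialAvg_local hj U U' c hUU']

variable [MeasurableSpace G] [RegularGaugeGroup G]

/-- The hybrid averaging is measurable (measurable small-loop average `E`). [folklore] -/
theorem measurable_hybrid (hE : ∀ n, Measurable fun W : Fin (n + 1) → G => ℰ.E W) (S : Finset (PBond P (j + 1))) :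
    Measurable fun U : GaugeField P j G => (fun c => if c ∈ S then avgFun ℰ U c else axialAvg U c : GaugeField P (j + 1) G) := by
  refine measurable_pi_lambda _ fun c => ?_
  by_cases hc : c ∈ S
  · simp only [if_pos hc]
    exact (measurable_pi_apply c).comp (measurable_avgFun ℰ hE)
  · simp only [if_neg hc]
    exact (measurable_pi_apply c).comp measurable_axialAvg

end Hybrid

/-! ## §2 The positive polymer partition of the one-step transport -/

section Partition

variable {P : Params} {j : ℕ} {G : Type*} [GaugeGroup G] (ℰ : LoopAverage G) [MeasurableSpace G] [RegularGaugeGroup G]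

/-- The event «the guard set at `U` is exactly `S`» is measurable. [folklore] -/
theorem measurableSet_guardEq (S : Finset (PBond P (j + 1))) :
    MeasurableSet {U : GaugeField P j G | ∀ c, Small ℰ U c ↔ c ∈ S} := by
  have : {U : GaugeField P j G | ∀ c, Small ℰ U c ↔ c ∈ S} = ⋂ c, {U : GaugeField P j G | Small ℰ U c ↔ c ∈ S} := by
    ext U; simp only [Set.mem_setOf_eq, Set.mem_iInter]
  rw [this]
  refine MeasurableSet.iInter fun c => ?_
  by_cases hc : c ∈ S
  · have h1 : {U : GaugeField P j G | Small ℰ U c ↔ c ∈ S} = {U : GaugeField P j G | Small ℰ U c} := by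
      ext U; simp only [Set.mem_setOf_eq, hc, iff_true]
    rw [h1]; exact measurableSet_small ℰ c
  · have h1 : {U : GaugeField P j G | Small ℰ U c ↔ c ∈ S} = {U : GaugeField P j G | Small ℰ U c}ᶜ := by
      ext U; simp only [Set.mem_setOf_eq, hc, iff_false, Set.mem_compl_iff]
    rw [h1]; exact (measurableSet_small ℰ c).compl

/-- The event «every bond of `S` is guarded» is measurable. [folklore] -/
theorem measurableSet_guardAll (S : Finset (PBond P (j + 1))) :
    MeasurableSet {U : GaugeField P j G | ∀ c ∈ S, Small ℰ U c} := by
  have : {U : GaugeField P j G | ∀ c ∈ S, Small ℰ U c} = ⋂ c ∈ S, {U : GaugeField P j G | Small ℰ U c} := by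
    ext U; simp only [Set.mem_setOf_eq, Set.mem_iInter]
  rw [this]
  exact S.measurableSet_biInter fun c _ => measurableSet_small ℰ c

/-- The event «no bond outside `S` is guarded» is measurable. [folklore] -/
theorem measurableSet_noGuardOff (S : Finset (PBond P (j + 1))) :
    MeasurableSet {U : GaugeField P j G | ∀ c, c ∉ S → ¬ Small ℰ U c} := by
  have : {U : GaugeField P j G | ∀ c, c ∉ S → ¬ Small ℰ U c} = ⋂ c ∈ (Sᶜ : Finset (PBond P (j + 1))), {U : GaugeField P j G | Small ℰ U c}ᶜ := by
    classical
    ext U; simp only [Set.mem_setOf_eq, Set.mem_iInter, Finset.mem_compl, Set.mem_compl_iff]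
  rw [this]
  classical
  exact (Sᶜ : Finset (PBond P (j + 1))).measurableSet_biInter fun c _ => (measurableSet_small ℰ c).compl

omit [MeasurableSpace G] [RegularGaugeGroup G] in
/-- The guard-set events are pairwise disjoint. [folklore] -/
theorem pairwiseDisjoint_guardEq :
    (Set.univ : Set (Finset (PBond P (j + 1)))).PairwiseDisjoint fun S => {U : GaugeField P j G | ∀ c, Small ℰ U c ↔ c ∈ S} := by
  intro S _ S' _ hSS'
  refine Set.disjoint_left.2 fun U hU hU' => hSS' (Finset.ext fun c => ?_)
  exact (hU c).symm.trans (hU' c)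

omit [MeasurableSpace G] [RegularGaugeGroup G] in
/-- The guard-set events cover: `U` lies in the event of `S = {c | Small U c}`. [folklore] -/
theorem exists_mem_guardEq (U : GaugeField P j G) : ∃ S : Finset (PBond P (j + 1)), U ∈ {U : GaugeField P j G | ∀ c, Small ℰ U c ↔ c ∈ S} := by
  classical
  exact ⟨Finset.univ.filter fun c => Small ℰ U c, fun c => by simp only [Finset.mem_filter, Finset.mem_univ, true_and]⟩

/-- **THE PARTITION OF AN ARBITRARY MEASURE BY THE GUARD SET**: `μ = Σ_S μ↾{U | {c | Small U c} = S}`. [folklore] -/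
theorem eq_sum_restrict_guardEq (μ : Measure (GaugeField P j G)) :
    μ = ∑ S : Finset (PBond P (j + 1)), μ.restrict {U : GaugeField P j G | ∀ c, Small ℰ U c ↔ c ∈ S} := by
  ext t ht
  rw [Measure.finsetSum_apply]
  simp_rw [Measure.restrict_apply ht]
  have hcover : t = ⋃ S ∈ (Finset.univ : Finset (Finset (PBond P (j + 1)))), t ∩ {U : GaugeField P j G | ∀ c, Small ℰ U c ↔ c ∈ S} := by
    ext U
    simp only [Set.mem_iUnion, Finset.mem_univ, exists_true_left, Set.mem_inter_iff]
    constructor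
    · intro hU
      obtain ⟨S, hS⟩ := exists_mem_guardEq ℰ U
      exact ⟨S, hU, hS⟩
    · rintro ⟨S, hU, -⟩; exact hU
  conv_lhs => rw [hcover]
  refine measure_biUnion_finset ?_ fun S _ => ht.inter (measurableSet_guardEq ℰ S)
  intro S hS S' hS' hSS'
  exact Disjoint.mono Set.inter_subset_right Set.inter_subset_right (pairwiseDisjoint_guardEq ℰ (Set.mem_univ S) (Set.mem_univ S') hSS')

/-- The exact partition has total mass `μ(univ)`: `Σ_S μ{guard set = S} = μ(univ)`. [folklore] -/
theorem sum_measure_guardEq_eq (μ : Measure (GaugeField P j G)) :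
    ∑ S : Finset (PBond P (j + 1)), μ {U : GaugeField P j G | ∀ c, Small ℰ U c ↔ c ∈ S} = μ Set.univ := by
  have h := congrArg (fun ν : Measure (GaugeField P j G) => ν Set.univ) (eq_sum_restrict_guardEq ℰ μ)
  simp only [Measure.finsetSum_apply, Measure.restrict_apply_univ] at h
  exact h.symm

/-- Push-forward of a finite sum of measures along a measurable map (plumbing). [folklore] -/
theorem map_finset_sum {X Y : Type*} [MeasurableSpace X] [MeasurableSpace Y] {g : X → Y} (hg : Measurable g) {ι : Type*}
    (s : Finset ι) (μ : ι → Measure X) :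
    Measure.map g (∑ i ∈ s, μ i) = ∑ i ∈ s, Measure.map g (μ i) := by
  classical
  induction s using Finset.induction_on with
  | empty => rw [Finset.sum_empty, Finset.sum_empty, Measure.map_zero]
  | insert a s ha ih => rw [Finset.sum_insert ha, Finset.sum_insert ha, Measure.map_add _ _ hg, ih]

variable [DecidableEq (PBond P (j + 1))]

/-- **ONE `S`: ON «NO GUARD OUTSIDE `S`» PRINT'S TRANSPORT IS THE HYBRID TRANSPORT**: `(μ↾{∀ c ∉ S, ¬Small})∘Ū⁻¹ = (μ↾{∀ c ∉ S, ¬Small})∘(Ū^S)⁻¹` for every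
measure `μ`. [cite: Balaban1987RG1, (0.4) p.253 (bookkeeping)] -/
theorem map_restrict_noGuardOff_eq_map_hybrid (S : Finset (PBond P (j + 1))) (μ : Measure (GaugeField P j G)) :
    (μ.restrict {U : GaugeField P j G | ∀ c, c ∉ S → ¬ Small ℰ U c}).map (avgFun ℰ) =
      (μ.restrict {U : GaugeField P j G | ∀ c, c ∉ S → ¬ Small ℰ U c}).map
        (fun U => (fun c => if c ∈ S then avgFun ℰ U c else axialAvg U c : GaugeField P (j + 1) G)) := by
  refine Measure.map_congr ?_
  filter_upwards [ae_restrict_mem (measurableSet_noGuardOff ℰ S)] with U hU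
  exact avgFun_eq_hybrid_of_forall_not_small ℰ S hU

/-- On the exact guard-set event print's transport is the hybrid transport. [cite: Balaban1987RG1, (0.4) p.253 (bookkeeping)] -/
theorem map_restrict_guardEq_eq_map_hybrid (S : Finset (PBond P (j + 1))) (μ : Measure (GaugeField P j G)) :
    (μ.restrict {U : GaugeField P j G | ∀ c, Small ℰ U c ↔ c ∈ S}).map (avgFun ℰ) =
      (μ.restrict {U : GaugeField P j G | ∀ c, Small ℰ U c ↔ c ∈ S}).map
        (fun U => (fun c => if c ∈ S then avgFun ℰ U c else axialAvg U c : GaugeField P (j + 1) G)) := by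
  refine Measure.map_congr ?_
  filter_upwards [ae_restrict_mem (measurableSet_guardEq ℰ S)] with U hU
  exact avgFun_eq_hybrid_of_forall_not_small ℰ S fun c hc h => hc ((hU c).1 h)

/-- ★★ **THE EXACT POLYMER PARTITION OF THE ONE-STEP TRANSPORT**: for EVERY measure `μ` on level-`j` fields and every measurable small-loop average,
`μ∘Ū⁻¹ = Σ_{S ⊆ PBond(j+1)} (μ↾{U | {c | Small U c} = S})∘(Ū^S)⁻¹` — on the event that the guarded bonds are exactly `S`, print's averaging is the hybrid
averaging `Ū^S` (typed (0.4) on `S`, axial off `S`). [cite: Balaban1987RG1, (0.4) p.253 (the typed averaging; bookkeeping); Balaban1985UV3, (2) p.256] -/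
theorem map_avgFun_eq_sum_map_hybrid (hE : ∀ n, Measurable fun W : Fin (n + 1) → G => ℰ.E W) (μ : Measure (GaugeField P j G)) :
    μ.map (avgFun ℰ) = ∑ S : Finset (PBond P (j + 1)),
      (μ.restrict {U : GaugeField P j G | ∀ c, Small ℰ U c ↔ c ∈ S}).map
        (fun U => (fun c => if c ∈ S then avgFun ℰ U c else axialAvg U c : GaugeField P (j + 1) G)) := by
  conv_lhs => rw [eq_sum_restrict_guardEq ℰ μ]
  rw [map_finset_sum (measurable_avgFun ℰ hE)]
  exact Finset.sum_congr rfl fun S _ => map_restrict_guardEq_eq_map_hybrid ℰ S μ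

/-- ★★ **THE POSITIVE POLYMER BOUND**: `μ∘Ū⁻¹ ≤ Σ_{S ⊆ PBond(j+1)} (μ↾G_S)∘(Ū^S)⁻¹`, `G_S = {U | ∀ c ∈ S, Small U c}` — the exact partition with the conditions
«unguarded off `S`» DROPPED (no signs; each summand's input event reads only the end blocks of `S`, `loopHol_local`).  This is the shape in which road (ii) sums the
one-step transport: `S = ∅` is the axial transport of `μ` itself, `S ≠ ∅` are the guarded parts carried by `Ū^S`.
[cite: Balaban1987RG1, (0.4) p.253 (bookkeeping); Balaban1985UV3, (2) p.256 + (48)–(49) p.268 (the split of the fine integral)] -/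
theorem map_avgFun_le_sum_map_hybrid (hE : ∀ n, Measurable fun W : Fin (n + 1) → G => ℰ.E W) (μ : Measure (GaugeField P j G)) :
    μ.map (avgFun ℰ) ≤ ∑ S : Finset (PBond P (j + 1)),
      (μ.restrict {U : GaugeField P j G | ∀ c ∈ S, Small ℰ U c}).map
        (fun U => (fun c => if c ∈ S then avgFun ℰ U c else axialAvg U c : GaugeField P (j + 1) G)) := by
  rw [map_avgFun_eq_sum_map_hybrid ℰ hE μ]
  exact Finset.sum_le_sum (ι := Finset (PBond P (j + 1))) (N := Measure (GaugeField P (j + 1) G)) fun S _ =>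
    Measure.map_mono (Measure.restrict_mono (fun U hU c hc => (hU c).2 hc) le_rfl) (measurable_hybrid ℰ hE S)

omit [RegularGaugeGroup G] in
/-- The `S = ∅` summand of the positive polymer bound is the axial transport of the whole of `μ`. [folklore] -/
theorem map_restrict_guardAll_empty (μ : Measure (GaugeField P j G)) :
    (μ.restrict {U : GaugeField P j G | ∀ c ∈ (∅ : Finset (PBond P (j + 1))), Small ℰ U c}).map
        (fun U => (fun c => if c ∈ (∅ : Finset (PBond P (j + 1))) then avgFun ℰ U c else axialAvg U c : GaugeField P (j + 1) G)) =
      μ.map axialAvg := by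
  have h1 : {U : GaugeField P j G | ∀ c ∈ (∅ : Finset (PBond P (j + 1))), Small ℰ U c} = Set.univ :=
    Set.eq_univ_of_forall fun U c hc => absurd hc (Finset.notMem_empty c)
  rw [h1, Measure.restrict_univ]
  rfl

end Partition

/-! ## §3 At the [B10] slot's averaging `avOfPrint N S₀ j` on `SU(N)` -/

section Slot

open Literature.MathematicalPhysics.QuantumFieldTheory.Balaban1985CMP102.Setting (Scales)
open Literature.MathematicalPhysics.QuantumFieldTheory.Balaban1983to89.B10RunsOfRecord (avOfPrint)
open Literature.MathematicalPhysics.QuantumFieldTheory.Balaban1983to89.ExpMeanLog (expMeanLogSU measurable_expMeanLogSU_E)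
open Literature.MathematicalPhysics.QuantumFieldTheory.Balaban1983to89.Node00 (SU)
open Summit.QuantumFields.YangMills.BalabanUVNodes.N08HaarCompatibilityGuard (avOfPrint_avg_of_le)

variable (N : ℕ) [NeZero N] {L : ℕ}

/-- ★★ **AT THE SLOT, EXACT**: for print's averaging `avOfPrint N S₀ j` on `SU(N)` (every `N`, standing range) and every input measure `μ`:
`μ∘Ū⁻¹ = Σ_S (μ↾{guard set = S})∘(Ū^S)⁻¹` with `Ū^S` the hybrid of the printed exp-mean-log averaging on `S` and the axial averaging off `S`.
[cite: Balaban1985UV3, (2) p.256; Balaban1985Averaging, (15) p.19; Balaban1987RG1, (0.4) p.253 (bookkeeping)] -/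
theorem map_avOfPrint_eq_sum_map_hybrid (S₀ : Scales L) {j : ℕ} (hj : j + 1 ≤ S₀.P.m + S₀.P.K) [DecidableEq (PBond S₀.P (j + 1))]
    (μ : Measure (GaugeField S₀.P j (SU N))) :
    μ.map (avOfPrint N S₀ j).avg = ∑ S : Finset (PBond S₀.P (j + 1)),
      (μ.restrict {U : GaugeField S₀.P j (SU N) | ∀ c, Small (expMeanLogSU : LoopAverage (SU N)) U c ↔ c ∈ S}).map
        (fun U => (fun c => if c ∈ S then avgFun (expMeanLogSU : LoopAverage (SU N)) U c else axialAvg U c : GaugeField S₀.P (j + 1) (SU N))) := by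
  rw [avOfPrint_avg_of_le N S₀ hj]
  exact map_avgFun_eq_sum_map_hybrid _ measurable_expMeanLogSU_E μ

/-- ★★ **AT THE SLOT, THE POSITIVE POLYMER BOUND**: `μ∘Ū⁻¹ ≤ Σ_S (μ↾{∀ c ∈ S, Small U c})∘(Ū^S)⁻¹` for print's averaging on `SU(N)`, every `N`, every `μ`.
[cite: Balaban1985UV3, (2) p.256 + (48)–(49) p.268; Balaban1987RG1, (0.4) p.253 (bookkeeping)] -/
theorem map_avOfPrint_le_sum_map_hybrid (S₀ : Scales L) {j : ℕ} (hj : j + 1 ≤ S₀.P.m + S₀.P.K) [DecidableEq (PBond S₀.P (j + 1))]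
    (μ : Measure (GaugeField S₀.P j (SU N))) :
    μ.map (avOfPrint N S₀ j).avg ≤ ∑ S : Finset (PBond S₀.P (j + 1)),
      (μ.restrict {U : GaugeField S₀.P j (SU N) | ∀ c ∈ S, Small (expMeanLogSU : LoopAverage (SU N)) U c}).map
        (fun U => (fun c => if c ∈ S then avgFun (expMeanLogSU : LoopAverage (SU N)) U c else axialAvg U c : GaugeField S₀.P (j + 1) (SU N))) := by
  rw [avOfPrint_avg_of_le N S₀ hj]
  exact map_avgFun_le_sum_map_hybrid _ measurable_expMeanLogSU_E μ

/-- **AT THE SLOT, ONE `S`**: on «no guard outside `S`» print's transport is the hybrid transport. [cite: Balaban1985UV3, (2) p.256; Balaban1987RG1, (0.4) p.253 (bookkeeping)] -/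
theorem map_restrict_noGuardOff_avOfPrint_eq (S₀ : Scales L) {j : ℕ} (hj : j + 1 ≤ S₀.P.m + S₀.P.K) [DecidableEq (PBond S₀.P (j + 1))]
    (S : Finset (PBond S₀.P (j + 1))) (μ : Measure (GaugeField S₀.P j (SU N))) :
    (μ.restrict {U : GaugeField S₀.P j (SU N) | ∀ c, c ∉ S → ¬ Small (expMeanLogSU : LoopAverage (SU N)) U c}).map (avOfPrint N S₀ j).avg =
      (μ.restrict {U : GaugeField S₀.P j (SU N) | ∀ c, c ∉ S → ¬ Small (expMeanLogSU : LoopAverage (SU N)) U c}).map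
        (fun U => (fun c => if c ∈ S then avgFun (expMeanLogSU : LoopAverage (SU N)) U c else axialAvg U c : GaugeField S₀.P (j + 1) (SU N))) := by
  rw [avOfPrint_avg_of_le N S₀ hj]
  exact map_restrict_noGuardOff_eq_map_hybrid _ S μ

end Slot

end Summit.QuantumFields.YangMills.BalabanUVNodes.N08HaarCompatibilityGuardHybridPartition

end
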